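import Summits.QuantumFields.BalabanUV.Beta.RowD1JointEndSym
import Summits.QuantumFields.BalabanUV.Beta.WardLocusSymShift

/-!
# `BalabanUV.Beta.RowD1JointEndSymShift` — binder row D1: THE ROW'S END AT THE SHIFTED STRAIGHT SPREAD OF RULING R-D1-g28-1, AND THE LITERAL ROOT
# WITH THE (Sd) LETTER DISCHARGED — `RowD1JointEndSym.d1Drift_JsB12Sym_of_shiftLetters_D1Tel_D1Rep : … → D1Drift Lc (JsB12Sym hLc N tabs cΛ cB) Nc μ ν`
# displaying, on the hW side, ONLY the border letter (V-d) of `tabs.V`, the shift's (Dspr)(Dnull), and the second-order letter (Wd) with the PINNED generator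

HONEST FRAMING (cell charter, verbatim): «discharging BetaPertH makes Balaban's UV stability UNCONDITIONAL — a real constructive-QFT result; it is
NOT the continuum limit and NOT the Clay problem.»  HONEST DEPENDENCY: continuum YM on T⁴ ⇐ BetaPertH ∧ nine spine estimates (0/9 proved);
BetaPertH ⇐ (D1) ∧ (D4) ∧ CAP+tail; G-an2-4 gates asym, D1 and NE2/3/4.
DERIVED cell leaf (β sub-cell, BINDER-OWNERS row D1 OWNER `b2b-balaban-beta-an2`, gen 28; RULING R-D1-g28-1 on an1-g36's X-an2-55 line).  The namespace
`RowD1JointEndSym` spans files (the root file is at the 400-line cap; `RowD1JointEndSymLiteral` holds §7).  §8 = the root's §4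
(`d1Drift_dressSymCtr_of_wardSockets_compensated_D1Tel_D1Rep`, generic Ward-side ∕ hR-side spreads with `Spr`∕`RelInv` sockets) INSTANTIATED at the spread of
record of R-D1-g28-1, `𝕄ʷ j = 𝕄 j := bhKStepSh 3 Lc Dsh j = bhKStep 3 Lc j + stepScale 3 Lc j • Dsh`, `E := symEc Lc`: the sockets are DISCHARGED by
`SymShiftedSpread.spr_bhKStepSh` and the transferred K3-b `RelInvNullShift.relInv_coDressKSymAt_KInvStep_bhKStep_add` from the two displayed letters (Dspr) `Spr Dsh`,
(Dnull) `symEc ∘ Dsh ∘ symEc = 0`; the ℋ-column law by `KernelWardHColumnSym` (as §6).  §9 = §8 at the literal `Js⁰ := JsB12Sym0 hLc N tabs cΛ cB` with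
(St)(Wt) by `SymmetrisedStepJets` AND **(Sd) by `WardLocusSymShift.hSd_JsB12Sym0`** from (V-d)+(Dspr)+(Dnull), the Ward generator PINNED to
`Xʷ j y := diagK (½ • Σ_{v∈box} legInd ρ_c (Lc•y+v))` (its `Loc` and `symEc`-commutation by `KernelWardLevels` ∕ `SymSliceProjectorDiagComm`).
WHAT §9 DISPLAYS (= the row's binder denominator at the literal after R-D1-g28-1; every one a hypothesis, none proved anywhere): the table record `tabs`;
the shift `Dsh` with (Dspr)(Dnull)(V-d); the second-order Ward letter (Wd) of `(JsB12Sym0 …).W` against `bhKStepSh 3 Lc Dsh j` with the pinned generator,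
localised `symEc`-commuting contact data `X₂ʷ` and a parity-odd remainder `Nr`; the conjugated reflection letters (Sr-conj)(Wr-conj-c) against `bhKStepSh 3 Lc Dsh j`
with contacts `C`, `X₂` and compensator `Wc`; `hcomp`; `D1Tel`; `D1Rep`; the printed B5 facts `h12`∕`h126`; the window.  HONEST COUNT: root-level classes
{hW-letters — now (V-d)(Dspr)(Dnull)(Wd) —, hR-letters, hcomp, D1Tel, D1Rep}: 0∕5 discharged; table VALUES 0∕5 in tree; NOT D1, NOT `BetaPertH`, NOT continuum,
NOT Clay.  No statement of Bałaban's papers, no `[cite:]`, no `Prop` fact, no `def`.  Provenance: β sub-cell, unit beta-an2 gen 28, 2026-08-21 (v1); over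
`RowD1JointEndSym` §4 (p250829∕p251630), `WardLocusSymShift`, `SymShiftedSpread`, `RelInvNullShift`, `SymmetrisedStepJets` BY NAME; no existing file touched.
-/

open Finset
open scoped BigOperators
open Literature.MathematicalPhysics.QuantumFieldTheory
open Literature.MathematicalPhysics.QuantumFieldTheory.Balaban1983to89
open Literature.MathematicalPhysics.QuantumFieldTheory.Balaban1983to89.Beta
open Literature.MathematicalPhysics.QuantumFieldTheory.Balaban1983to89.Beta.VectorTailsLoc (fam kfam)
open Literature.MathematicalPhysics.QuantumFieldTheory.Balaban1983to89.Beta.VectorLegVolumeAdapter (MvE)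
open ExpKernelCalculus (MKer Decays BiLoc comp tr tadpole shiftK)
open AffineAveraging (box toSite)
open AveragingContoursRooted (ctr ctrOff ctrOff_mem_box)
open PolarizationSign (reflSign WardTransversal AxisReflectionCovariant)
open KernelReflection (refK)
open ResolventReflection (bref Φ)
open OneStepResolventKernel (Fib LocStencil JetData)
open OneStepKernelFamily (KInvStep vertexOfK TbalOf flipK D1Tel D1Rep D1Drift)
open Summit.QuantumFields.BalabanUV.Beta.TameKernelCalculus
open Summit.QuantumFields.BalabanUV.Beta.ChartConjugation (conjV conjW)
open Summit.QuantumFields.BalabanUV.Beta.ChartConjugationDefectEnd (conjDefect)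
open Summit.QuantumFields.BalabanUV.Beta.AxialDressingRooted (one_le_of_neZero)
open Summit.QuantumFields.BalabanUV.Beta.SymmetrisedDressingKernel (coDressKSymAt)
open Summit.QuantumFields.BalabanUV.Beta.SymmetrisedDressingDress (dressSymAt)
open Summit.QuantumFields.BalabanUV.Beta.AveragingWardRootedStencils (legInd)
open Summit.QuantumFields.BalabanUV.Beta.WardLocusStencils (ffK)
open Summit.QuantumFields.BalabanUV.Beta.SymmetrisedStepJets (SymTables JsB12Sym0 JsB12Sym JsB12Sym0_S_translate JsB12Sym0_W_translate)
open Summit.QuantumFields.BalabanUV.Beta.SymShiftedSpread (bhKStepSh spr_bhKStepSh)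
open Summit.QuantumFields.BalabanUV.Beta.RelInvNullShift (relInv_coDressKSymAt_KInvStep_bhKStep_add)
open Summit.QuantumFields.BalabanUV.Beta.WardLocusSymShift (hSd_JsB12Sym0)

namespace Summit.QuantumFields.BalabanUV.Beta.RowD1JointEndSym

noncomputable section

variable {Lc : ℕ} [NeZero Lc]

/-! ## §8 The row's END at the shifted straight spread `bhKStepSh 3 Lc Dsh j` ∕ `symEc Lc`: `Spr`, `RelInv`, ℋ-column sockets discharged -/

open B6BondElimination (unitVec) in
open KernelWard (divV divW) in
open Summit.QuantumFields.BalabanUV.Beta.BorderedHessian (sgnK bhK bhKStep stepScale diagK) in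
open Summit.QuantumFields.BalabanUV.Beta.SymSliceProjectorKernel (symEc) in
open Summit.QuantumFields.BalabanUV.Beta.SymSliceProjectorSpread (spr_symEc) in
open Summit.QuantumFields.BalabanUV.Beta.KernelWardHColumnSym (colH_ward_coDressKSymAt_KInvStep) in
/-- **ROW D1, SYMMETRISED LITERAL, JetData-LEVEL END AT THE SHIFTED STRAIGHT SPREAD** (RULING R-D1-g28-1).  §4 with `𝕄ʷ j = 𝕄 j := bhKStepSh 3 Lc Dsh j`,
`E := symEc Lc`; the sockets `Spr (bhKStepSh 3 Lc Dsh j)`, `Spr (symEc Lc)`, `RelInv G_j (bhKStepSh 3 Lc Dsh j) (symEc Lc)` (every `j`) DISCHARGED from (Dspr)(Dnull) by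
`spr_bhKStepSh`, `spr_symEc`, `relInv_coDressKSymAt_KInvStep_bhKStep_add`; the ℋ-column law by `colH_ward_coDressKSymAt_KInvStep` at `cH j = (stepScale 3 Lc j·Lc⁴)⁻¹`.
Displayed: the jet letters (St)(Wt)(Sd)(Wd) against `bhKStepSh 3 Lc Dsh j` ∕ `symEc Lc`, the hR letters (Sr-conj)(Wr-conj-c), `hcomp`, `D1Tel`, `D1Rep`, the printed B5
facts, the window.  HONEST: bookkeeping; 0∕5 root-level classes discharged. -/
theorem d1Drift_dressSymCtr_of_letters_bhKStepSh_symEc_D1Tel_D1Rep (hLc : Odd Lc) (hL2 : 2 ≤ Lc) (Js : ℕ → JetData 3 Lc)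
    -- the shift of R-D1-g28-1 and its two spread-side letters
    (Dsh : MKer 4 (Fib 3)) (hD : Spr Dsh) (hDnull : comp (comp (symEc Lc) Dsh) (symEc Lc) = 0)
    -- hW: the Ward letters of the undressed jets against `bhKStepSh 3 Lc Dsh j` ∕ `symEc Lc`
    (hSt : ∀ (j : ℕ) (κ' : Fin 4) (u t : Fin 4 → ℤ), (Js j).S κ' (u + (Lc : ℤ) • t) = ExpKernelCalculus.shiftK (-((Lc : ℤ) • t)) ((Js j).S κ' u))
    (hWt : ∀ (j : ℕ) (μ : Fin 4) (y : Fin 4 → ℤ) (ν : Fin 4) (y' t : Fin 4 → ℤ),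
      (Js j).W μ (y + t) ν (y' + t) = ExpKernelCalculus.shiftK (-((Lc : ℤ) • t)) ((Js j).W μ y ν y'))
    (Xw : ℕ → (Fin 4 → ℤ) → MKer 4 (Fib 3)) (hXw : ∀ j y, Loc (Xw j y)) (hEXw : ∀ j y, comp (symEc Lc) (Xw j y) = comp (Xw j y) (symEc Lc))
    (X₂w Nr : ℕ → (Fin 4 → ℤ) → Fin 4 → (Fin 4 → ℤ) → MKer 4 (Fib 3)) (hX₂w : ∀ j y ν y', Loc (X₂w j y ν y'))
    (hNr : ∀ j y ν y', Loc (Nr j y ν y')) (hEX₂w : ∀ j y ν y', comp (symEc Lc) (X₂w j y ν y') = comp (X₂w j y ν y') (symEc Lc))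
    (hSd : ∀ (j : ℕ) (y : Fin 4 → ℤ),
      (stepScale 3 Lc j * (Lc : ℝ) ^ (3 + 1))⁻¹ • ∑ v ∈ box 4 Lc, divV (Js j).S ((Lc : ℤ) • y + toSite v) = conjV (bhKStepSh 3 Lc Dsh j) (Xw j y))
    (hWd : ∀ (j : ℕ) (y : Fin 4 → ℤ) (ν : Fin 4) (y' : Fin 4 → ℤ),
      divW (Js j).W y ν y' = conjW (bhKStepSh 3 Lc Dsh j) 0 (vertexOfK (coDressKSymAt (toSite (ctrOff 4 Lc)) Lc (KInvStep (d := 3) Lc j)) Lc (Js j).S ν y')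
        (Xw j y) 0 (X₂w j y ν y') + Nr j y ν y')
    (hNt : ∀ j y ν y', trK (Nr j y ν y') = -sgnK (Nr j y ν y'))
    -- hR ∧ hSX: the compensated letters against `bhKStepSh 3 Lc Dsh j`
    (C : ℕ → Fin 4 → Fin 4 → (Fin 4 → ℤ) → MKer 4 (Fib 3)) (Cc δc : ℕ → ℝ) (hC : ∀ j α, LocStencil (C j α) (Cc j) (δc j))
    (hδc : ∀ j, 0 < δc j) (X₂ Wc : ℕ → Fin 4 → Fin 4 → (Fin 4 → ℤ) → Fin 4 → (Fin 4 → ℤ) → MKer 4 (Fib 3))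
    (hX₂ : ∀ j α μ y ν y', Loc (X₂ j α μ y ν y')) (hWc : ∀ j α μ y ν y', Loc (Wc j α μ y ν y'))
    (hSrC : ∀ (j : ℕ) (α κ' : Fin 4) (u : Fin 4 → ℤ),
      (Js j).S κ' (bref α κ' u) = reflSign α κ' • refK (Φ Lc α) ((Js j).S κ' u + conjV (bhKStepSh 3 Lc Dsh j) (C j α κ' u)))
    (hWrC : ∀ (j : ℕ) (α μ : Fin 4) (y : Fin 4 → ℤ) (ν : Fin 4) (y' : Fin 4 → ℤ),
      (Js j).W μ (bref α μ y) ν (bref α ν y') = (reflSign α μ * reflSign α ν) • refK (Φ Lc α) ((Js j).W μ y ν y' +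
        conjW (bhKStepSh 3 Lc Dsh j) (vertexOfK (coDressKSymAt (toSite (ctrOff 4 Lc)) Lc (KInvStep (d := 3) Lc j)) Lc (Js j).S μ y)
          (vertexOfK (coDressKSymAt (toSite (ctrOff 4 Lc)) Lc (KInvStep (d := 3) Lc j)) Lc (Js j).S ν y')
          (vertexOfK (coDressKSymAt (toSite (ctrOff 4 Lc)) Lc (KInvStep (d := 3) Lc j)) Lc (C j α) μ y)
          (vertexOfK (coDressKSymAt (toSite (ctrOff 4 Lc)) Lc (KInvStep (d := 3) Lc j)) Lc (C j α) ν y') (X₂ j α μ y ν y')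
          + Wc j α μ y ν y'))
    (hcomp : ∀ (j : ℕ) (α μ : Fin 4) (y : Fin 4 → ℤ) (ν : Fin 4) (y' : Fin 4 → ℤ),
      (1 / 2 : ℝ) * tadpole (coDressKSymAt (toSite (ctrOff 4 Lc)) Lc (KInvStep (d := 3) Lc j)) (Wc j α μ y ν y')
        + conjDefect (coDressKSymAt (toSite (ctrOff 4 Lc)) Lc (KInvStep (d := 3) Lc j)) (bhKStepSh 3 Lc Dsh j)
            (vertexOfK (coDressKSymAt (toSite (ctrOff 4 Lc)) Lc (KInvStep (d := 3) Lc j)) Lc (Js j).S μ y)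
            (vertexOfK (coDressKSymAt (toSite (ctrOff 4 Lc)) Lc (KInvStep (d := 3) Lc j)) Lc (Js j).S ν y')
            (vertexOfK (coDressKSymAt (toSite (ctrOff 4 Lc)) Lc (KInvStep (d := 3) Lc j)) Lc (C j α) μ y)
            (vertexOfK (coDressKSymAt (toSite (ctrOff 4 Lc)) Lc (KInvStep (d := 3) Lc j)) Lc (C j α) ν y') (X₂ j α μ y ν y') = 0)
    -- the route theorem's own binders, verbatim
    (a : ℝ) (ha : 0 < a)
    (h12 : B5.Prop12Printed (fam (fun i : ℕ+ × ℕ => ((i.1 : ℕ+) : ℕ)) (fun i => i.1.pos) MvE a ha))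
    (h126 : B5.Kernel126_127Printed (kfam (fun i : ℕ+ × ℕ => ((i.1 : ℕ+) : ℕ)) MvE))
    {L : Type*} {SL : Finset L} (hSL : SL.Nonempty) (k : L → Fin 4) {μ ν : Fin 4} (hμν : μ ≠ ν) {Nc : ℝ} (hNc : Nc ≠ 0)
    (Jc : ∀ m : ℕ, JetData 3 (Lc ^ m))
    (htel : D1Tel Lc (fun j => dressSymAt (ctrOff_mem_box (d := 4) (one_le_of_neZero Lc)) (Js j)) Jc)
    {cc : ℝ} {Mw' : ℕ → ℕ} (hc : 1 ≤ cc) (hMwin : ∀ L : ℕ, 2 ≤ L → 1 ≤ Mw' L ∧ (L : ℝ) ≤ cc * Mw' L) (hML : ∀ L : ℕ, 2 ≤ L → Mw' L ≤ L)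
    (hrep : D1Rep Lc Jc Nc μ ν a SL k) :
    D1Drift Lc (fun j => dressSymAt (ctrOff_mem_box (d := 4) (one_le_of_neZero Lc)) (Js j)) Nc μ ν :=
  d1Drift_dressSymCtr_of_wardSockets_compensated_D1Tel_D1Rep hLc hL2 Js
    (fun j => bhKStepSh 3 Lc Dsh j) (symEc Lc) (spr_bhKStepSh hD) (spr_symEc (one_le_of_neZero Lc))
    (fun j => relInv_coDressKSymAt_KInvStep_bhKStep_add (d := 3) (Lc := Lc) j hD hDnull (stepScale 3 Lc j))
    hSt hWt (fun j => (stepScale 3 Lc j * (Lc : ℝ) ^ (3 + 1))⁻¹)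
    (fun j y κ' u => colH_ward_coDressKSymAt_KInvStep (d := 3) (Lc := Lc) j y κ' u)
    Xw hXw hEXw X₂w Nr hX₂w hNr hEX₂w hSd hWd hNt
    (fun j => bhKStepSh 3 Lc Dsh j) (spr_bhKStepSh hD)
    C Cc δc hC hδc X₂ Wc hX₂ hWc hSrC hWrC hcomp a ha h12 h126 hSL k hμν hNc Jc htel hc hMwin hML hrep

/-! ## §9 The literal root with (St)(Wt) AND (Sd) discharged; the Ward generator pinned -/

open B6BondElimination (unitVec) in
open KernelWard (divV divW) in
open Summit.QuantumFields.BalabanUV.Beta.BorderedHessian (sgnK bhK bhKStep stepScale diagK) in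
open Summit.QuantumFields.BalabanUV.Beta.SymSliceProjectorKernel (symEc) in
open Summit.QuantumFields.BalabanUV.Beta.KernelWardLevels (loc_diagK_smul_sum_legInd) in
open Summit.QuantumFields.BalabanUV.Beta.SymSliceProjectorDiagComm (comp_symEc_blockGen_comm) in
/-- **ROW D1 — THE LITERAL ROOT AFTER RULING R-D1-g28-1**: `D1Drift Lc (JsB12Sym hLc N tabs cΛ cB) Nc μ ν` with the first-order Ward class of the hW side
REDUCED to the border letter (V-d) of `tabs.V` plus the shift's (Dspr)(Dnull) — (St)(Wt) by `SymmetrisedStepJets`, **(Sd) by `WardLocusSymShift.hSd_JsB12Sym0`**,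
generator `Xʷ j y := diagK (½ • Σ_{v∈box} legInd ρ_c (Lc•y+v))` (localised, `symEc`-commuting: theorems).  Displayed: `tabs`; `Dsh` with (Dspr)(Dnull)(V-d); (Wd)
with the pinned generator, `X₂ʷ`, parity-odd `Nr`; (Sr-conj)(Wr-conj-c) against `bhKStepSh 3 Lc Dsh j` with `C`, `X₂`, `Wc`; `hcomp`; `D1Tel`; `D1Rep`; `h12`∕`h126`;
the window.  HONEST: statement + composition by name; 0∕5 root-level classes discharged (hW-letters = (V-d)(Dspr)(Dnull)(Wd)); tables 0∕5. -/
theorem d1Drift_JsB12Sym_of_shiftLetters_D1Tel_D1Rep (hLc : Odd Lc) (hL2 : 2 ≤ Lc) (N : ℕ) (tabs : SymTables 3 Lc) (cΛ cB : ℝ)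
    -- the shift of R-D1-g28-1: (Dspr)(Dnull) and the border letter (V-d) of `tabs.V`
    (Dsh : MKer 4 (Fib 3)) (hD : Spr Dsh) (hDnull : comp (comp (symEc Lc) Dsh) (symEc Lc) = 0)
    (hVd : ∀ u : Fin 4 → ℤ, conjV (bhK Lc + Dsh) (diagK (legInd (ctr 4 Lc) u)) =
      conjV (ffK (bhK (d := 3) Lc)) (diagK (legInd (ctr 4 Lc) u)) - ((Lc : ℝ) ^ 4) • divV tabs.V u)
    -- hW: the second-order Ward letter with the PINNED generator
    (X₂w Nr : ℕ → (Fin 4 → ℤ) → Fin 4 → (Fin 4 → ℤ) → MKer 4 (Fib 3)) (hX₂w : ∀ j y ν y', Loc (X₂w j y ν y'))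
    (hNr : ∀ j y ν y', Loc (Nr j y ν y')) (hEX₂w : ∀ j y ν y', comp (symEc Lc) (X₂w j y ν y') = comp (X₂w j y ν y') (symEc Lc))
    (hWd : ∀ (j : ℕ) (y : Fin 4 → ℤ) (ν : Fin 4) (y' : Fin 4 → ℤ),
      divW (JsB12Sym0 hLc N tabs cΛ cB j).W y ν y' =
        conjW (bhKStepSh 3 Lc Dsh j) 0 (vertexOfK (coDressKSymAt (toSite (ctrOff 4 Lc)) Lc (KInvStep (d := 3) Lc j)) Lc (JsB12Sym0 hLc N tabs cΛ cB j).S ν y')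
          (diagK ((1 / 2 : ℝ) • ∑ v ∈ box 4 Lc, legInd (ctr 4 Lc) ((Lc : ℤ) • y + toSite v))) 0 (X₂w j y ν y') + Nr j y ν y')
    (hNt : ∀ j y ν y', trK (Nr j y ν y') = -sgnK (Nr j y ν y'))
    -- hR ∧ hSX: the compensated letters against `bhKStepSh 3 Lc Dsh j`
    (C : ℕ → Fin 4 → Fin 4 → (Fin 4 → ℤ) → MKer 4 (Fib 3)) (Cc δc : ℕ → ℝ) (hC : ∀ j α, LocStencil (C j α) (Cc j) (δc j))
    (hδc : ∀ j, 0 < δc j) (X₂ Wc : ℕ → Fin 4 → Fin 4 → (Fin 4 → ℤ) → Fin 4 → (Fin 4 → ℤ) → MKer 4 (Fib 3))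
    (hX₂ : ∀ j α μ y ν y', Loc (X₂ j α μ y ν y')) (hWc : ∀ j α μ y ν y', Loc (Wc j α μ y ν y'))
    (hSrC : ∀ (j : ℕ) (α κ' : Fin 4) (u : Fin 4 → ℤ),
      (JsB12Sym0 hLc N tabs cΛ cB j).S κ' (bref α κ' u) =
        reflSign α κ' • refK (Φ Lc α) ((JsB12Sym0 hLc N tabs cΛ cB j).S κ' u + conjV (bhKStepSh 3 Lc Dsh j) (C j α κ' u)))
    (hWrC : ∀ (j : ℕ) (α μ : Fin 4) (y : Fin 4 → ℤ) (ν : Fin 4) (y' : Fin 4 → ℤ),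
      (JsB12Sym0 hLc N tabs cΛ cB j).W μ (bref α μ y) ν (bref α ν y') = (reflSign α μ * reflSign α ν) • refK (Φ Lc α) ((JsB12Sym0 hLc N tabs cΛ cB j).W μ y ν y' +
        conjW (bhKStepSh 3 Lc Dsh j) (vertexOfK (coDressKSymAt (toSite (ctrOff 4 Lc)) Lc (KInvStep (d := 3) Lc j)) Lc (JsB12Sym0 hLc N tabs cΛ cB j).S μ y)
          (vertexOfK (coDressKSymAt (toSite (ctrOff 4 Lc)) Lc (KInvStep (d := 3) Lc j)) Lc (JsB12Sym0 hLc N tabs cΛ cB j).S ν y')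
          (vertexOfK (coDressKSymAt (toSite (ctrOff 4 Lc)) Lc (KInvStep (d := 3) Lc j)) Lc (C j α) μ y)
          (vertexOfK (coDressKSymAt (toSite (ctrOff 4 Lc)) Lc (KInvStep (d := 3) Lc j)) Lc (C j α) ν y') (X₂ j α μ y ν y')
          + Wc j α μ y ν y'))
    (hcomp : ∀ (j : ℕ) (α μ : Fin 4) (y : Fin 4 → ℤ) (ν : Fin 4) (y' : Fin 4 → ℤ),
      (1 / 2 : ℝ) * tadpole (coDressKSymAt (toSite (ctrOff 4 Lc)) Lc (KInvStep (d := 3) Lc j)) (Wc j α μ y ν y')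
        + conjDefect (coDressKSymAt (toSite (ctrOff 4 Lc)) Lc (KInvStep (d := 3) Lc j)) (bhKStepSh 3 Lc Dsh j)
            (vertexOfK (coDressKSymAt (toSite (ctrOff 4 Lc)) Lc (KInvStep (d := 3) Lc j)) Lc (JsB12Sym0 hLc N tabs cΛ cB j).S μ y)
            (vertexOfK (coDressKSymAt (toSite (ctrOff 4 Lc)) Lc (KInvStep (d := 3) Lc j)) Lc (JsB12Sym0 hLc N tabs cΛ cB j).S ν y')
            (vertexOfK (coDressKSymAt (toSite (ctrOff 4 Lc)) Lc (KInvStep (d := 3) Lc j)) Lc (C j α) μ y)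
            (vertexOfK (coDressKSymAt (toSite (ctrOff 4 Lc)) Lc (KInvStep (d := 3) Lc j)) Lc (C j α) ν y') (X₂ j α μ y ν y') = 0)
    -- the route theorem's own binders, verbatim
    (a : ℝ) (ha : 0 < a)
    (h12 : B5.Prop12Printed (fam (fun i : ℕ+ × ℕ => ((i.1 : ℕ+) : ℕ)) (fun i => i.1.pos) MvE a ha))
    (h126 : B5.Kernel126_127Printed (kfam (fun i : ℕ+ × ℕ => ((i.1 : ℕ+) : ℕ)) MvE))
    {L : Type*} {SL : Finset L} (hSL : SL.Nonempty) (k : L → Fin 4) {μ ν : Fin 4} (hμν : μ ≠ ν) {Nc : ℝ} (hNc : Nc ≠ 0)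
    (Jc : ∀ m : ℕ, JetData 3 (Lc ^ m))
    (htel : D1Tel Lc (JsB12Sym hLc N tabs cΛ cB) Jc)
    {cc : ℝ} {Mw' : ℕ → ℕ} (hc : 1 ≤ cc) (hMwin : ∀ L : ℕ, 2 ≤ L → 1 ≤ Mw' L ∧ (L : ℝ) ≤ cc * Mw' L) (hML : ∀ L : ℕ, 2 ≤ L → Mw' L ≤ L)
    (hrep : D1Rep Lc Jc Nc μ ν a SL k) :
    D1Drift Lc (JsB12Sym hLc N tabs cΛ cB) Nc μ ν :=
  d1Drift_dressSymCtr_of_letters_bhKStepSh_symEc_D1Tel_D1Rep hLc hL2 (JsB12Sym0 hLc N tabs cΛ cB) Dsh hD hDnull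
    (JsB12Sym0_S_translate hLc N tabs cΛ cB) (JsB12Sym0_W_translate hLc N tabs cΛ cB)
    (fun _ y => diagK ((1 / 2 : ℝ) • ∑ v ∈ box 4 Lc, legInd (ctr 4 Lc) ((Lc : ℤ) • y + toSite v)))
    (fun _ y => loc_diagK_smul_sum_legInd Lc (ctr 4 Lc) (1 / 2 : ℝ) y)
    (fun _ y => comp_symEc_blockGen_comm (one_le_of_neZero Lc) (ctr 4 Lc) (1 / 2 : ℝ) y)
    X₂w Nr hX₂w hNr hEX₂w (hSd_JsB12Sym0 hLc N tabs cΛ cB hD hDnull hVd) hWd hNt C Cc δc hC hδc X₂ Wc hX₂ hWc hSrC hWrC hcomp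
    a ha h12 h126 hSL k hμν hNc Jc htel hc hMwin hML hrep

end

end Summit.QuantumFields.BalabanUV.Beta.RowD1JointEndSym
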